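import Mathlib
import Literature.Analysis.Calculus.JointSmoothnessPartials
import Summits.FinalStateConjecture.FinalStateConjecture.Theorems.PhotonSphereChannelsUniformPhotonSphereChannelsRPeelSeed
import Summits.FinalStateConjecture.FinalStateConjecture.Theorems.PhotonSphereChannelsUniformPhotonSphereChannelsRPeelPrimitive

/-!
# Peeling, file 5: one energy-level Darboux rung `θ ↦ θ̃ = (∂ₓ − W) ∂ₜ⁻¹ θ` — construction

Support file for `stub_peel` of the line `crum-peeling-recessive-tower` (crux
`UniformPhotonSphereChannelsR`, stmt-FinalStateConjecture-14074).

Data on the half-plane `H = ℝ × (a, ∞)`: a smooth superpotential `W` on `(a, ∞)` with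
`W' = U − W²` (so `H_U = −∂ₓ² + U = A*A`, `A = ∂ₓ − W`, `A* = −∂ₓ − W`), the partner
`Ũ = 2W² − U = W² − W'` (`H_Ũ = AA*`), the recessive normalisation `x W ≤ −3/4` far out, and a `C²`
solution `θ` of `θ_tt − θ_xx + Uθ = 0` on `H` with `θ_t(0, ·) ∈ L²` far out.  With the seed
`w = exp ∫ W` (`w' = Ww`, `w ∈ L²`), the tail `G(x) = ∫_x^∞ w θ_t(0, ·)`, `η = −G/w` (so that
`A*η = −θ_t(0,·)` and `η` is the finite-energy branch), and the time primitives
`P = ∫₀ᵗ θ`, `Q = ∫₀ᵗ θ_x`, the rung is the explicit function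

  `θ̃(t, x) = η(x) + Q(t, x) − W(x) P(t, x)`.

`exists_rung`: `θ̃ ∈ C²(H)`, `θ̃_t = θ_x − Wθ` (`= Aθ`), `θ̃_x = θ_t − Wθ̃` (`A*θ̃ = −θ_t`),
`θ̃_tt − θ̃_xx + Ũθ̃ = 0` on `H`, and `w θ̃(0, ·) = −∫_·^∞ w θ_t(0, ·)`.  The energy bookkeeping of
the rung is in the next file.
-/

noncomputable section

-- the doubled `FinalStateConjecture` component is the tree's fixed summit/problem path
set_option linter.dupNamespace false

namespace Summit.FinalStateConjecture.FinalStateConjecture.Theorems.CrumPeelingRecessiveTower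

open MeasureTheory Set Filter Topology intervalIntegral
open scoped ContDiff

/-- `C²` regularity on an open set of the plane from `C¹` partial derivatives given in the
one-variable `HasDerivAt` language. -/
theorem contDiffOn_two_of_hasDerivAt_partials {f f₁ f₂ : ℝ → ℝ → ℝ} {O : Set (ℝ × ℝ)}
    (hO : IsOpen O) (h₁ : ∀ p ∈ O, HasDerivAt (fun t => f t p.2) (f₁ p.1 p.2) p.1)
    (h₂ : ∀ p ∈ O, HasDerivAt (f p.1) (f₂ p.1 p.2) p.2)
    (hc₁ : ContDiffOn ℝ 1 (Function.uncurry f₁) O) (hc₂ : ContDiffOn ℝ 1 (Function.uncurry f₂) O) :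
    ContDiffOn ℝ 2 (Function.uncurry f) O := by
  have hL : ContDiff ℝ 1 fun c : ℝ => (1 : ℝ →L[ℝ] ℝ).smulRight c :=
    (ContinuousLinearMap.smulRightL ℝ ℝ ℝ (1 : ℝ →L[ℝ] ℝ)).contDiff.of_le le_top
  have h := Literature.Analysis.Calculus.contDiffOn_succ_of_partial (f := Function.uncurry f) hO
    (f₁ := fun p => (1 : ℝ →L[ℝ] ℝ).smulRight (f₁ p.1 p.2))
    (f₂ := fun p => (1 : ℝ →L[ℝ] ℝ).smulRight (f₂ p.1 p.2)) (n := 1)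
    (fun p hp => (h₁ p hp).hasFDerivAt) (fun p hp => (h₂ p hp).hasFDerivAt)
    (hL.comp_contDiffOn hc₁) (hL.comp_contDiffOn hc₂)
  exact_mod_cast h

/-- **One Darboux rung, construction.**  See the module docstring. -/
theorem exists_rung {a : ℝ} {U Ut W : ℝ → ℝ} {θ : ℝ → ℝ → ℝ}
    (hW : ContDiffOn ℝ ∞ W (Ioi a)) (hWd : ∀ x, a < x → HasDerivAt W (U x - W x ^ 2) x)
    (hUt : ∀ x, a < x → Ut x = 2 * W x ^ 2 - U x)
    (hrec : ∃ X₁, a < X₁ ∧ 0 < X₁ ∧ ∀ x, X₁ ≤ x → x * W x ≤ -3 / 4)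
    (hθ : ContDiffOn ℝ 2 (Function.uncurry θ) {z : ℝ × ℝ | a < z.2})
    (hsol : ∀ t x, a < x →
      iteratedDeriv 2 (fun τ => θ τ x) t - iteratedDeriv 2 (θ t) x + U x * θ t x = 0)
    (hL2 : ∀ X, a < X → IntegrableOn (fun x => deriv (fun τ => θ τ x) 0 ^ 2) (Ioi X)) :
    ∃ (θn : ℝ → ℝ → ℝ) (w : ℝ → ℝ),
      (∀ x, a < x → 0 < w x) ∧ (∀ x, a < x → HasDerivAt w (W x * w x) x) ∧
      ContDiffOn ℝ ∞ w (Ioi a) ∧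
      ContDiffOn ℝ 2 (Function.uncurry θn) {z : ℝ × ℝ | a < z.2} ∧
      (∀ t x, a < x →
        iteratedDeriv 2 (fun τ => θn τ x) t - iteratedDeriv 2 (θn t) x + Ut x * θn t x = 0) ∧
      (∀ t x, a < x → deriv (fun τ => θn τ x) t = deriv (θ t) x - W x * θ t x) ∧
      (∀ t x, a < x → deriv (θn t) x = deriv (fun τ => θ τ x) t - W x * θn t x) ∧
      (∀ X, a < X → IntegrableOn (fun y => w y * deriv (fun τ => θ τ y) 0) (Ioi X)) ∧
      (∀ x, a < x → w x * θn 0 x = -∫ y in Ioi x, w y * deriv (fun τ => θ τ y) 0) := by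
  have hH : IsOpen {z : ℝ × ℝ | a < z.2} := isOpen_lt continuous_const continuous_snd
  obtain ⟨X₁, haX₁, hX₁0, hrec⟩ := hrec
  -- the dictionary of partials of `θ`
  obtain ⟨dt, dx, dtt, dtx, dxx, hct, hcx, hctt, -, -, hC1t, hC1x, h1, h2, h3, h4, h5, h6, h7, h8⟩ :=
    halfPlane_partials hθ
  have hpde : ∀ t x, a < x → dxx t x = dtt t x + U x * θ t x := by
    intro t x hx
    have h := hsol t x hx
    rw [h7 t x hx, h8 t x hx] at h
    linarith
  -- the seed
  obtain ⟨w, hw0, hwd, hwC⟩ := exists_seed hW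
  have hwc : ContinuousOn w (Ioi a) := hwC.continuousOn
  -- the integrand `g₀ = w θ_t(0, ·)` of the tail
  set g₀ : ℝ → ℝ := fun y => w y * dt 0 y with hg₀
  have hdt0C : ContDiffOn ℝ 1 (dt 0) (Ioi a) :=
    hC1t.comp (contDiffOn_const.prodMk contDiffOn_id) fun y hy => hy
  have hg₀C : ContDiffOn ℝ 1 g₀ (Ioi a) := (hwC.of_le (WithTop.coe_le_coe.2 le_top)).mul hdt0C
  have hg₀c : ContinuousOn g₀ (Ioi a) := hg₀C.continuousOn
  have hg₀i : ∀ X, a < X → IntegrableOn g₀ (Ioi X) := by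
    intro X hX
    have hm1 : AEStronglyMeasurable w (volume.restrict (Ioi X)) :=
      (hwc.mono (Ioi_subset_Ioi hX.le)).aestronglyMeasurable measurableSet_Ioi
    have hm2 : AEStronglyMeasurable (dt 0) (volume.restrict (Ioi X)) :=
      (hdt0C.continuousOn.mono (Ioi_subset_Ioi hX.le)).aestronglyMeasurable measurableSet_Ioi
    have hsq1 : IntegrableOn (fun y => w y ^ 2) (Ioi X) :=
      seed_sq_integrableOn haX₁ hX₁0 hw0 hwd hrec hX
    have hsq2 : IntegrableOn (fun y => dt 0 y ^ 2) (Ioi X) :=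
      (hL2 X hX).congr_fun (fun y hy => by simp only [(h1 0 y (hX.trans hy)).deriv]) measurableSet_Ioi
    exact integrableOn_mul_of_sq hm1 hm2 hsq1 hsq2
  -- the tail `G` and `η = −G/w`
  set G : ℝ → ℝ := fun x => ∫ y in Ioi x, g₀ y with hG
  have hGd : ∀ x, a < x → HasDerivAt G (-g₀ x) x := by
    intro x hx
    have hX' : a < (a + x) / 2 := by linarith
    exact Literature.Analysis.ODE.hasDerivAt_integral_Ioi
      (hg₀c.mono fun y hy => lt_of_lt_of_le hX' hy) (hg₀i _ hX') (by linarith)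
  have hGC : ContDiffOn ℝ 2 G (Ioi a) := by
    rw [show (2 : WithTop ℕ∞) = 1 + 1 by norm_num, contDiffOn_succ_iff_deriv_of_isOpen isOpen_Ioi]
    refine ⟨fun x hx => (hGd x hx).differentiableAt.differentiableWithinAt, fun h => ?_, ?_⟩
    · exact absurd h (by norm_num)
    · exact hg₀C.neg.congr fun x hx => (hGd x hx).deriv
  set η : ℝ → ℝ := fun x => -G x / w x with hη
  have hηC : ContDiffOn ℝ 2 η (Ioi a) :=
    (hGC.neg.div (hwC.of_le (WithTop.coe_le_coe.2 le_top)) fun x hx => (hw0 x hx).ne')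
  have hηd : ∀ x, a < x → HasDerivAt η (dt 0 x - W x * η x) x := by
    intro x hx
    have hwx := (hw0 x hx).ne'
    have h : HasDerivAt (fun y => -G y / w y)
        ((-(-g₀ x) * w x - -G x * (W x * w x)) / w x ^ 2) x :=
      ((hGd x hx).neg.div (hwd x hx) hwx)
    have he : (-(-g₀ x) * w x - -G x * (W x * w x)) / w x ^ 2 = dt 0 x - W x * η x := by
      simp only [hg₀, hη]
      field_simp
    rw [he] at h
    exact h
  -- the time primitives
  set P : ℝ → ℝ → ℝ := fun t x => ∫ s in (0 : ℝ)..t, θ s x with hP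
  set Q : ℝ → ℝ → ℝ := fun t x => ∫ s in (0 : ℝ)..t, dx s x with hQ
  have hPC : ContDiffOn ℝ 2 (Function.uncurry P) {z : ℝ × ℝ | a < z.2} :=
    contDiffOn_timePrimitive (n := 2) hθ
  have hPt : ∀ t x, a < x → HasDerivAt (fun τ => P τ x) (θ t x) t := fun t x hx =>
    hasDerivAt_timePrimitive_fst hθ.continuousOn t hx
  have hQt : ∀ t x, a < x → HasDerivAt (fun τ => Q τ x) (dx t x) t := fun t x hx =>
    hasDerivAt_timePrimitive_fst hcx t hx
  have hPx : ∀ t x, a < x → HasDerivAt (P t) (Q t x) x := by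
    intro t x hx
    have h := hasDerivAt_timePrimitive_snd (hθ.of_le (by norm_num)) t hx
    have he : (∫ s in (0 : ℝ)..t, deriv (θ s) x) = Q t x :=
      intervalIntegral.integral_congr fun s _ => (h2 s x hx).deriv
    rw [he] at h
    exact h
  have hQx : ∀ t x, a < x → HasDerivAt (Q t) (dt t x - dt 0 x + U x * P t x) x := by
    intro t x hx
    have h := hasDerivAt_timePrimitive_snd (θ := dx) hC1x t hx
    have hcont : Continuous fun s => dtt s x := continuous_slice_fst hctt hx
    have hcont' : Continuous fun s => θ s x := continuous_slice_fst hθ.continuousOn hx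
    have he : (∫ s in (0 : ℝ)..t, deriv (dx s) x) = dt t x - dt 0 x + U x * P t x := by
      have e1 : (∫ s in (0 : ℝ)..t, deriv (dx s) x) = ∫ s in (0 : ℝ)..t, (dtt s x + U x * θ s x) :=
        intervalIntegral.integral_congr fun s _ => by rw [(h6 s x hx).deriv, hpde s x hx]
      rw [e1, intervalIntegral.integral_add (hcont.intervalIntegrable _ _)
        ((hcont'.const_mul _).intervalIntegrable _ _), intervalIntegral.integral_const_mul,
        integral_eq_sub_of_hasDerivAt (fun s _ => h3 s x hx) (hcont.intervalIntegrable _ _)]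
    rw [he] at h
    exact h
  -- `Q ∈ C²(H)` from its partials `Q_t = θ_x`, `Q_x = θ_t − θ_t(0,·) + U P`
  have hUC : ContDiffOn ℝ ∞ U (Ioi a) := by
    have hdW : ContDiffOn ℝ ∞ (deriv W) (Ioi a) := hW.deriv_of_isOpen isOpen_Ioi le_rfl
    refine (hdW.add (hW.pow 2)).congr fun x hx => ?_
    have := (hWd x hx).deriv
    simp only [this]
    ring
  have hQC : ContDiffOn ℝ 2 (Function.uncurry Q) {z : ℝ × ℝ | a < z.2} := by
    refine contDiffOn_two_of_hasDerivAt_partials hH (f₁ := dx)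
      (f₂ := fun t x => dt t x - dt 0 x + U x * P t x) (fun p hp => hQt p.1 p.2 hp)
      (fun p hp => hQx p.1 p.2 hp) hC1x ?_
    have hA : ContDiffOn ℝ 1 (fun p : ℝ × ℝ => dt 0 p.2) {z : ℝ × ℝ | a < z.2} :=
      hC1t.comp (contDiffOn_const.prodMk contDiffOn_snd) fun p hp => hp
    have hB : ContDiffOn ℝ 1 (fun p : ℝ × ℝ => U p.2) {z : ℝ × ℝ | a < z.2} :=
      (hUC.of_le (WithTop.coe_le_coe.2 le_top)).comp contDiffOn_snd fun p hp => hp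
    exact (hC1t.sub hA).add (hB.mul (hPC.of_le (by norm_num)))
  -- the rung
  set θn : ℝ → ℝ → ℝ := fun t x => η x + Q t x - W x * P t x with hθn
  have hθnC : ContDiffOn ℝ 2 (Function.uncurry θn) {z : ℝ × ℝ | a < z.2} := by
    have hA : ContDiffOn ℝ 2 (fun p : ℝ × ℝ => η p.2) {z : ℝ × ℝ | a < z.2} :=
      hηC.comp contDiffOn_snd fun p hp => hp
    have hB : ContDiffOn ℝ 2 (fun p : ℝ × ℝ => W p.2) {z : ℝ × ℝ | a < z.2} :=
      (hW.of_le (WithTop.coe_le_coe.2 le_top)).comp contDiffOn_snd fun p hp => hp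
    exact (hA.add hQC).sub (hB.mul hPC)
  have hθnt : ∀ t x, a < x → HasDerivAt (fun τ => θn τ x) (dx t x - W x * θ t x) t := by
    intro t x hx
    have h := ((hQt t x hx).const_add (η x)).sub ((hPt t x hx).const_mul (W x))
    exact h
  have hθnx : ∀ t x, a < x → HasDerivAt (θn t) (dt t x - W x * θn t x) x := by
    intro t x hx
    have h := ((hηd x hx).add (hQx t x hx)).sub ((hWd x hx).mul (hPx t x hx))
    have he : dt 0 x - W x * η x + (dt t x - dt 0 x + U x * P t x)
        - ((U x - W x ^ 2) * P t x + W x * Q t x) = dt t x - W x * θn t x := by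
      simp only [hθn]; ring
    rw [he] at h
    exact h
  have hθn0 : ∀ x, θn 0 x = η x := fun x => by
    simp only [hθn, hP, hQ, intervalIntegral.integral_same]; ring
  refine ⟨θn, w, hw0, hwd, hwC, hθnC, fun t x hx => ?_, fun t x hx => ?_, fun t x hx => ?_,
    fun X hX => ?_, fun x hx => ?_⟩
  · -- the wave equation for `θn`
    have hWx := hWd x hx
    -- second `t`-derivative
    have hT : iteratedDeriv 2 (fun τ => θn τ x) t = dtx t x - W x * dt t x := by
      rw [iteratedDeriv_succ, iteratedDeriv_one]
      have e : deriv (fun τ => θn τ x) = fun τ => dx τ x - W x * θ τ x :=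
        funext fun τ => (hθnt τ x hx).deriv
      rw [e]
      exact ((h4 t x hx).sub ((h1 t x hx).const_mul (W x))).deriv
    -- second `x`-derivative
    have hX : iteratedDeriv 2 (θn t) x
        = dtx t x - ((U x - W x ^ 2) * θn t x + W x * (dt t x - W x * θn t x)) := by
      rw [iteratedDeriv_succ, iteratedDeriv_one]
      have e : deriv (θn t) =ᶠ[𝓝 x] fun y => dt t y - W y * θn t y := by
        filter_upwards [Ioi_mem_nhds hx] with y hy
        exact (hθnx t y hy).deriv
      rw [e.deriv_eq]
      exact ((h5 t x hx).sub (hWx.mul (hθnx t x hx))).deriv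
    rw [hT, hX, hUt x hx]
    ring
  · rw [(hθnt t x hx).deriv, (h2 t x hx).deriv]
  · rw [(hθnx t x hx).deriv, (h1 t x hx).deriv]
  · exact (hg₀i X hX).congr_fun (fun y hy => by simp only [hg₀, (h1 0 y (hX.trans hy)).deriv])
      measurableSet_Ioi
  · rw [hθn0 x]
    have hwx := (hw0 x hx).ne'
    have e : (∫ y in Ioi x, w y * deriv (fun τ => θ τ y) 0) = G x := by
      refine setIntegral_congr_fun measurableSet_Ioi fun y hy => ?_
      simp only [hg₀, (h1 0 y (hx.trans hy)).deriv]
    rw [e]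
    simp only [hη]
    field_simp

/-- Registered sub-goal `peel_partialsC2` of `stub_peel` (verbatim signature): `C²` regularity on an open planar set from `C¹` one-variable partial derivatives. -/
theorem peel_partialsC2 : ∀ (f f₁ f₂ : ℝ → ℝ → ℝ) (O : Set (ℝ × ℝ)), IsOpen O → (∀ p ∈ O, HasDerivAt (fun t => f t p.2) (f₁ p.1 p.2) p.1) → (∀ p ∈ O, HasDerivAt (f p.1) (f₂ p.1 p.2) p.2) → ContDiffOn ℝ 1 (Function.uncurry f₁) O → ContDiffOn ℝ 1 (Function.uncurry f₂) O → ContDiffOn ℝ 2 (Function.uncurry f) O :=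
  fun _ _ _ _ hO h₁ h₂ hc₁ hc₂ => contDiffOn_two_of_hasDerivAt_partials hO h₁ h₂ hc₁ hc₂

end Summit.FinalStateConjecture.FinalStateConjecture.Theorems.CrumPeelingRecessiveTower
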